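import Summits.Ventures.PercRepro.ProfilePointedCircuitClassesInOutFourCircuit

/-!
# PercRepro — THE SINGLE 5-CIRCUIT CASE OF `InOutBottomFour` AT `ρ = 6` (p5, gen 39; `proofs/P5-GM1.md` §58 ADD 2)

On `#E = 10`, `ρ = 6`, at a point `e` whose only circuit with `≤ ρ − 1 = 5` elements is a 5-circuit `C = {e} ∪ C₀`
(`#C₀ = 4`), the single-circuit reduction (InOutFourCircuit) asks for `(★_C)` on the deletion `M = N ∖ e`
(nullity `3`, `9` points): `#{Y ∈ BI_3(M) : C₀ ⊄ Y} ≤ #{Z ∈ BI_5(M) : Z ∩ C₀ ≠ ∅}`.  No `3`-set contains `C₀`, so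
the left side is `P_3`; by complementation the right side is `P_4 − [C₀ ∈ BI_4]`; and the kernel's bottom step
`6·P_3 ≤ 4·P_4` gives `P_4 ≥ P_3 + 1` whenever `P_3 ≥ 1`.

* `card_filter_biIndepSets_five_compl` — `#{Z ∈ BI_5 : Z ∩ C₀ ≠ ∅} = #{V ∈ BI_4 : C₀ ⊄ V}` on `9` points;
* `star_core_of_nine_of_four` — `(★_C)` for `#C₀ = 4` on every nullity-`3` matroid on `9` points;
* **`inCount_four_le_outCount_five_of_fiveCircuit_of_six`** — the single 5-circuit case at `ρ = 6`.
-/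

open scoped Matroid

namespace PercRepro.Cogirth

open Finset ThmH Skew Shadow Profile

variable {α : Type} [DecidableEq α]

section FiveCore

variable {M : Matroid α} [M.Finite]

/-- On `9` points, the bi-independent `5`-sets meeting `C₀` correspond to the bi-independent `4`-sets not
containing `C₀`, by complementation. -/
theorem card_filter_biIndepSets_five_compl (h9 : (gr M).card = 9) {C₀ : Finset α} (hC : C₀ ⊆ gr M) :
    ((biIndepSets M 5).filter (fun Z => ¬ Disjoint Z C₀)).card =
      ((biIndepSets M 4).filter (fun V => ¬ C₀ ⊆ V)).card := by
  apply card_bij (fun Z _ => gr M \ Z)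
  · intro Z hZ
    rw [mem_filter, mem_biIndepSets] at hZ
    obtain ⟨⟨hZg, hZ5, hZr, hZc⟩, hZC⟩ := hZ
    rw [mem_filter, mem_biIndepSets]
    refine ⟨⟨sdiff_subset, ?_, hZc, ?_⟩, ?_⟩
    · rw [card_sdiff_of_subset hZg, hZ5, h9]
    · rw [Finset.sdiff_sdiff_eq_self hZg]; exact hZr
    · intro hCZ
      exact hZC (disjoint_left.2 fun a haZ haC => (mem_sdiff.1 (hCZ haC)).2 haZ)
  · intro Z₁ hZ₁ Z₂ hZ₂ h
    have h₁ : Z₁ ⊆ gr M := (mem_biIndepSets.1 (mem_filter.1 hZ₁).1).1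
    have h₂ : Z₂ ⊆ gr M := (mem_biIndepSets.1 (mem_filter.1 hZ₂).1).1
    rw [← Finset.sdiff_sdiff_eq_self h₁, ← Finset.sdiff_sdiff_eq_self h₂, h]
  · intro V hV
    rw [mem_filter, mem_biIndepSets] at hV
    obtain ⟨⟨hVg, hV4, hVr, hVc⟩, hVC⟩ := hV
    refine ⟨gr M \ V, ?_, Finset.sdiff_sdiff_eq_self hVg⟩
    rw [mem_filter, mem_biIndepSets]
    refine ⟨⟨sdiff_subset, ?_, hVc, ?_⟩, ?_⟩
    · rw [card_sdiff_of_subset hVg, hV4, h9]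
    · rw [Finset.sdiff_sdiff_eq_self hVg]; exact hVr
    · intro hd
      apply hVC
      intro a haC
      by_contra haV
      exact disjoint_left.1 hd (mem_sdiff.2 ⟨hC haC, haV⟩) haC

/-- **`(★_C)` AT NINE POINTS FOR A 4-SET `C₀`**: on every nullity-`3` matroid `M` on `9` points and every `4`-set
`C₀ ⊆ E`, `#{Y ∈ BI_3(M) : C₀ ⊄ Y} ≤ #{Z ∈ BI_5(M) : Z ∩ C₀ ≠ ∅}`. -/
theorem star_core_of_nine_of_four (hn : (gr M).card = rk M (gr M) + 3) (h9 : (gr M).card = 9)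
    {C₀ : Finset α} (hC : C₀ ⊆ gr M) (hC4 : C₀.card = 4) :
    ((biIndepSets M 3).filter (fun Y => ¬ C₀ ⊆ Y)).card ≤
      ((biIndepSets M 5).filter (fun Z => ¬ Disjoint Z C₀)).card := by
  rw [card_filter_biIndepSets_five_compl h9 hC]
  have hsplit := card_filter_add_card_filter_not (s := biIndepSets M 4) (fun V => C₀ ⊆ V)
  -- at most one bi-independent `4`-set contains the `4`-set `C₀`
  have hone : ((biIndepSets M 4).filter (fun V => C₀ ⊆ V)).card ≤ 1 := by
    apply card_le_one.2
    intro V₁ hV₁ V₂ hV₂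
    rw [mem_filter, mem_biIndepSets] at hV₁ hV₂
    have e₁ : V₁ = C₀ := (eq_of_subset_of_card_le hV₁.2 (by rw [hV₁.1.2.1, hC4])).symm
    have e₂ : V₂ = C₀ := (eq_of_subset_of_card_le hV₂.2 (by rw [hV₂.1.2.1, hC4])).symm
    rw [e₁, e₂]
  have hD : ((biIndepSets M 3).filter (fun Y => ¬ C₀ ⊆ Y)).card ≤ (biIndepSets M 3).card :=
    card_le_card (filter_subset _ _)
  have hstep := biIndep_step_three_of_nullity_three (N := M) hn (by omega)
  rw [h9] at hstep
  omega

end FiveCore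

section Assembly

variable {N : Matroid α} [N.Finite]

/-- **THE SINGLE 5-CIRCUIT CASE OF `InOutBottomFour` AT `ρ = 6`**: on `#E = 10`, `ρ(E) = 6`, with `e` not a
coloop, at a point `e` with `e ∈ cl(C₀)`, `#C₀ = 4`, such that every independent `4`-subset of `E − e`
capturing `e` contains (equals) `C₀`, `in_4(e) ≤ out_5(e)`. -/
theorem inCount_four_le_outCount_five_of_fiveCircuit_of_six (hn : (gr N).card = rk N (gr N) + 4)
    (hR : rk N (gr N) = 6) {e : α} (he : e ∈ gr N) (hnc : rk N ((gr N).erase e) = rk N (gr N))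
    {C₀ : Finset α} (hC : C₀ ⊆ (gr N).erase e) (hC4 : C₀.card = 4) (hcl : e ∈ clF N C₀)
    (honly : ∀ X ⊆ (gr N).erase e, X.card + 2 = rk N (gr N) → rk N X = X.card → e ∈ clF N X → C₀ ⊆ X) :
    inCount N 4 e ≤ outCount N 5 e := by
  refine inCount_four_le_outCount_five_of_single_circuit hn he hcl honly ?_
  have hgr : gr (N ＼ ({e} : Set α)) = (gr N).erase e := gr_delete'
  have hrkM : rk (N ＼ ({e} : Set α)) ((gr N).erase e) = rk N (gr N) := by
    rw [rk_delete (M := N) (e := e) (Subset.refl ((gr N).erase e))]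
    exact hnc
  have hnM : (gr (N ＼ ({e} : Set α))).card = rk (N ＼ ({e} : Set α)) (gr (N ＼ ({e} : Set α))) + 3 := by
    rw [hgr, hrkM, card_erase_of_mem he]
    omega
  have h9M : (gr (N ＼ ({e} : Set α))).card = 9 := by
    rw [hgr, card_erase_of_mem he]
    omega
  have hCM : C₀ ⊆ gr (N ＼ ({e} : Set α)) := by rw [hgr]; exact hC
  exact star_core_of_nine_of_four hnM h9M hCM hC4

end Assembly

end PercRepro.Cogirth
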